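import Summits.QuantumFields.YangMills.Theorems.BalabanUVNodesN18AtReadingOnTables
import Literature.MathematicalPhysics.QuantumFieldTheory.Balaban1983to89.Node00.HistoryRecursionOfRecord

/-!
# BalabanUVNodes ∕ node N18 = NE5 — N18 AT THE TOWERS OF THE RUNS OF RECORD `runTowers S`: the statement of record compares the runs' terms at the
# creation steps `j ≤ k` only, and the junction row asks the towers' H-layer data BELOW THE RUN LENGTH only
# (Track A, DAG node N18 = `T4OutputRate.NE5` :211; cluster K4 «SpineRates»; module 17 of seat pub-ymgap-dag-n18-d, strategy s2)

HONEST FRAMING.  Count-neutral kernel bookkeeping (`--supports … --as helper`), composition BY NAME of landed theorems; NE5 is NOT PRINTED and NOT proved;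
N18 is NOT discharged; no inhabitant of `IsDatumOfRecord₁₂C` is claimed (K0′); the towers `S′` stay a PARAMETER (the generators of record are not pinned).

WHY.  [I] (0.23)–(0.24): the run of `k` renormalization steps on the `k`-th torus creates the terms of creation steps `j = 1, …, k` and no others
(«E_k = Σ_{j=1}^{k} E^{(j)}»).  node00-def-W1 g4's `Node00/HistoryRecursionOfRecord` §1 (p489465) typed this as `runTowers S k := truncRun k (S k)` (the steps
`m < k` of `S k` kept, the steps `m ≥ k` TERMLESS), with `functionalC_truncRun_of_le` ∕ `functionalC_truncRun_eq_zero`; referee-F's standing rider on module 12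
(READ-175 (E3)): at W1's termless towers the admissible statement holds outright, so «a COUNT on N18 at this reading must pin the towers by name (`runTowers`)».
THIS FILE reads N18's statement of record (module 12 `s_N18_readingAdm₁₂_iff`, any table family `sp` with transport clause `hT`, any gauges ∕ transports ∕ letters)
AT `S := fun F θ ↦ runTowers (S′ F θ)`: run A (length `k`) and run B (length `k + 1`) BOTH vanish at the run-A creation steps `j > k` (`pairOfRecord_fst`:
run B is read at step `j + 1 > k + 1`), so the η-rate inequality there compares `0` with `0` and holds as soon as `0 ≤ C₅`, `0 ≤ θ₅`; below, the run towers ARE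
the towers.  Hence (§1) the statement of record at the run towers ⇔ the inequality for the UNTRUNCATED towers at the creation steps `j ≤ k` — `k + 1` levels per
run length; and (§2) module 12 §3's junction row at the run towers needs the towers' configuration-direction H-layer data (`AnalyticH` + `Bound238` on the tables)
at the steps `m < k` (run A) and `m < k + 1` (run B) ONLY — the termless steps are analytic and (2.38)-bounded outright (dag-n18-c's riders
`analyticH_termlessTower` ∕ `bound238_termlessTower`, W1's eliminator `truncRun_cases`): FINITE H-layer data per run.

WHAT (all `theorem`, 0 `def`).
* §1 `re_functionalC_runTowers_of_le` ∕ `re_functionalC_runTowers_eq_zero` (faces), ★ `s_N18_readingAdm₁₂_runTowers_iff` (statement of record at the run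
  towers ⇔ levels `j ≤ k` of the untruncated towers, under the sign letters), `le_of_s_N18_readingAdm₁₂_runTowers` (what it hands back below the run length, no
  sign letters), `s_N18_readingAdm₁₂_runTowers_of_forall_le` (θ-form sufficient condition at the levels `j ≤ k`).
* §2 ★ `s_N18_readingAdm₁₂_runTowers_of_envelope_bound238` (module 12 §3's row at the run towers, H-layer data below the run length only).

One finite four-torus programme at fixed `ε`; NOT the continuum limit, NOT OS, NOT a mass gap, NOT Clay.  0 `def`, 0 `sorry`.  Sources (TYPES only): T. Bałaban,
CMP **109** (1987) [Balaban1987RG1] (0.23)–(0.25) pp. 256–257, Thm 1 p. 259, (1.18) p. 263; CMP **116** (1988) [Balaban1988RG2Cluster] (2.13) p. 14, (2.16)–(2.18)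
p. 16 and Lemma 3 (2.38) p. 20.
-/

noncomputable section

open Set Metric
open scoped Matrix.Norms.L2Operator

namespace YMDAG.N18.W1Reading

open Literature.MathematicalPhysics.QuantumFieldTheory.Balaban1983to89
open Literature.MathematicalPhysics.QuantumFieldTheory.Balaban1983to89.T4Continuum
open Literature.MathematicalPhysics.QuantumFieldTheory.Balaban1983to89.T4OutputRate (Carriers Functional NE5 DecayBound Window)
open Literature.MathematicalPhysics.QuantumFieldTheory.Balaban1983to89.T4InputCauchyRateData (StepModel)
open Literature.MathematicalPhysics.QuantumFieldTheory.Balaban1983to89.B13Resummation (locE)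
open Literature.MathematicalPhysics.QuantumFieldTheory.Balaban1983to89.TreeLengthTorus (TDom tsys torusTreeLen)
open Literature.MathematicalPhysics.QuantumFieldTheory.Balaban1983to89.TreeLengthTorusGeometry (TTouch)
open Literature.MathematicalPhysics.QuantumFieldTheory.Balaban1983to89.B12TreeDecay (K₀)
open Literature.MathematicalPhysics.QuantumFieldTheory.Balaban1983to89.Node00 (Stage12Params IsDatumOfRecord₁₂C U3Letters₁₁ U3Objects₁₁ NE2Objects₁₁
  NE3Letters₁₁ RateAssignment₁₂ prependCoupling MatA ιSU avOfRecord)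
open Literature.MathematicalPhysics.QuantumFieldTheory.Balaban1983to89.Node00.Sect2 (domCount domSys CPair ofBackgroundC)
open Literature.MathematicalPhysics.QuantumFieldTheory.Balaban1983to89.Node00.W1 (ReadingData LevelPairing LetterInputs ClusterTower pairOfRecord
  dj_pairOfRecord functionalC functional box SpRestr truncRun runTowers termlessTower truncRun_cases functionalC_truncRun_of_le functionalC_truncRun_eq_zero)
open Summit.QuantumFields.BalabanUV.T4Continuum.B13Carriers (transportRaw)
open Summit.QuantumFields.BalabanUV.T4Continuum.Spine.NE5
open Summit.QuantumFields.YangMills.BalabanUVNodes.N18HLayerW1Config (analyticH_termlessTower bound238_termlessTower)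
open YMDAG.N18.HLayer
open YMDAG.UVSplit

variable {N : ℕ} [NeZero N]

section Record

variable (S : (F : T4Family) → (θ : Stage12Params F N) → (k : ℕ) → ClusterTower (F.P k) (MatA N) θ.τ9.M)
  (sp : (F : T4Family) → (θ : Stage12Params F N) → (k j : ℕ) → (domSys (F.P k) θ.τ9.M j).Dom → Set (CPair (F.P k) (MatA N)))
  (gauge : (F : T4Family) → (θ : Stage12Params F N) → (k : ℕ) → GaugeField (F.P k) 0 (Node00.SU N) → GaugeField (F.P k) 0 (Node00.SU N) → ℝ)
  (hg : ∀ (F : T4Family) (θ : Stage12Params F N) (k : ℕ) (U U' : GaugeField (F.P k) 0 (Node00.SU N)), 0 ≤ gauge F θ k U U')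
  (T₀ : (F : T4Family) → (θ : Stage12Params F N) → (k : ℕ) → GaugeField (F.P (k + 1)) 0 (Node00.SU N) → GaugeField (F.P k) 0 (Node00.SU N))
  (hT : ∀ (F : T4Family) (θ : Stage12Params F N) (k : ℕ) (U : GaugeField (F.P (k + 1)) 0 (Node00.SU N)),
    (∀ (j : ℕ) (Y : (domSys (F.P (k + 1)) θ.τ9.M j).Dom), ofBackgroundC (ιSU N) U ∈ sp F θ (k + 1) j Y) →
      ∀ (j : ℕ) (X : (domSys (F.P k) θ.τ9.M j).Dom), ofBackgroundC (ιSU N) (T₀ F θ k U) ∈ sp F θ k j X)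
  (li : (F : T4Family) → Stage12Params F N → LetterInputs) (ℓ₃ : T4Family → NE3Letters₁₁)
  (ne2 : (F : T4Family) → Stage12Params F N → (ℕ → ℝ) → List (ULoop F) → ℕ → NE2Objects₁₁)
  (ne1 : (F : T4Family) → Stage12Params F N → (ℕ → ℝ) → List (ULoop F) → NE1pCarriers)

/-! ## §1 The statement of record at the run towers: the creation steps `j ≤ k` only -/

/-- **BELOW THE RUN LENGTH THE RUN TOWER IS THE TOWER**: for a run-A domain `(j, X)` with `j ≤ k`, `Re E^{(j)}_{runTowers S′ k} = Re E^{(j)}_{S′ k}` and, at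
the paired run-B domain (creation step `j + 1 ≤ k + 1`), `Re E^{(j+1)}_{runTowers S′ (k+1)} = Re E^{(j+1)}_{S′ (k+1)}` (W1's `functionalC_truncRun_of_le`).
[cite: Balaban1987RG1, (0.23)-(0.24) pp.256-257 (bookkeeping)] -/
theorem re_functionalC_runTowers_of_le (F : T4Family) (θ : Stage12Params F N) (k : ℕ) (g g' : ℕ → ℝ) (φ : CPair (F.P k) (MatA N))
    (φ' : CPair (F.P (k + 1)) (MatA N)) (X : Node00.W1.Dom (F.P k) θ.τ9.M) (hX : X.1 ≤ k) :
    (functionalC (runTowers (S F θ) k) g φ X).re = (functionalC (S F θ k) g φ X).re ∧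
      (functionalC (runTowers (S F θ) (k + 1)) g' φ' (pairOfRecord F θ.τ9.M k X)).re =
        (functionalC (S F θ (k + 1)) g' φ' (pairOfRecord F θ.τ9.M k X)).re :=
  ⟨congrArg Complex.re (functionalC_truncRun_of_le (S F θ k) g φ X hX),
    congrArg Complex.re (functionalC_truncRun_of_le (S F θ (k + 1)) g' φ' (pairOfRecord F θ.τ9.M k X) (Nat.succ_le_succ hX))⟩

/-- **BEYOND THE RUN LENGTH BOTH RUNS VANISH**: for a run-A domain `(j, X)` with `k < j`, `Re E^{(j)}_{runTowers S′ k}(X; ·; ·) = 0` (run A creates no term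
after step `k`) AND `Re E^{(j+1)}_{runTowers S′ (k+1)}(πX; ·; ·) = 0` (run B creates no term after step `k + 1`, and `πX` has creation step `j + 1 > k + 1`)
— W1's `functionalC_truncRun_eq_zero` on both runs. [cite: Balaban1987RG1, (0.23)-(0.24) pp.256-257 (bookkeeping)] -/
theorem re_functionalC_runTowers_eq_zero (F : T4Family) (θ : Stage12Params F N) (k : ℕ) (g g' : ℕ → ℝ) (φ : CPair (F.P k) (MatA N))
    (φ' : CPair (F.P (k + 1)) (MatA N)) (X : Node00.W1.Dom (F.P k) θ.τ9.M) (hX : k < X.1) :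
    (functionalC (runTowers (S F θ) k) g φ X).re = 0 ∧ (functionalC (runTowers (S F θ) (k + 1)) g' φ' (pairOfRecord F θ.τ9.M k X)).re = 0 := by
  refine ⟨?_, ?_⟩
  · rw [show functionalC (runTowers (S F θ) k) g φ X = 0 from functionalC_truncRun_eq_zero (S F θ k) g φ X hX, Complex.zero_re]
  · rw [show functionalC (runTowers (S F θ) (k + 1)) g' φ' (pairOfRecord F θ.τ9.M k X) = 0 from
      functionalC_truncRun_eq_zero (S F θ (k + 1)) g' φ' (pairOfRecord F θ.τ9.M k X) (Nat.succ_lt_succ hX), Complex.zero_re]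

/-- ★ **N18's STATEMENT OF RECORD AT THE RUN TOWERS = THE CREATION STEPS `j ≤ k` OF THE UNTRUNCATED TOWERS** [bookkeeping; module 12 §2 `s_N18_readingAdm₁₂_iff` at
`S := fun F θ ↦ runTowers (S′ F θ)` + the two faces above].  Under the sign letters `0 ≤ C₅`, `0 ≤ θ₅` (the levels beyond the run length compare `0` with `0`):
`S_N18 (RRec₁₂ 𝔯_adm[runTowers S′])` ⇔ for every family `F`, datum key `h` (`θ := h.params`), run length `k`, member `b ∈ ]0, θ.γ]`, history `g ∈ ]0, θ.γ]^ℕ`,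
ADMISSIBLE run-B field `U` of the `(k+1)`-th torus and every run-A domain `(j, X)` WITH `j ≤ k`:
`|Re E^{(j)}_{S′_k}(X; g; (ι(T₀ U), 0)) − Re E^{(j+1)}_{S′_{k+1}}(πX; b∷g; (ιU, 0))| ≤ C₅ · θ₅ ^ j · e^{−κ·d_j(X)}` — `k + 1` levels per run length ([I] (0.23)).  NOT PRINTED;
NOT proved. [cite: Balaban1987RG1, (0.23)-(0.25) pp.256-257, Thm 1 p.259 and (1.18) p.263; Balaban1988RG2Cluster, (2.13) p.14 and (2.16)–(2.18) p.16] -/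
theorem s_N18_readingAdm₁₂_runTowers_iff (hC₅ : ∀ (F : T4Family) (θ : Stage12Params F N), 0 ≤ (li F θ).C₅)
    (hθ₅ : ∀ (F : T4Family) (θ : Stage12Params F N), 0 ≤ (li F θ).θ₅) :
    S_N18 (RRec₁₂ (readingOfRecord₁₂ (fun F θ => ReadingData.ofRecordAdm F θ.τ9.M N (runTowers (S F θ)) (sp F θ) (gauge F θ) (hg F θ) (T₀ F θ) (hT F θ)
      (li F θ)) ℓ₃ ne2 ne1)) ↔
      ∀ (F : T4Family) (D : Datum F N) (h : IsDatumOfRecord₁₂C F N D) (k : ℕ) (b : ℝ), 0 < b → b ≤ h.params.γ →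
        ∀ g ∈ Window h.params.γ,
          ∀ (U : {U : GaugeField (F.P (k + 1)) 0 (Node00.SU N) //
              ∀ (j : ℕ) (Y : (domSys (F.P (k + 1)) h.params.τ9.M j).Dom), ofBackgroundC (ιSU N) U ∈ sp F h.params (k + 1) j Y})
            (X : Node00.W1.Dom (F.P k) h.params.τ9.M), X.1 ≤ k →
          |(functionalC (S F h.params k) g (ofBackgroundC (ιSU N) (T₀ F h.params k U.1)) X).re -
              (functionalC (S F h.params (k + 1)) (prependCoupling b g) (ofBackgroundC (ιSU N) U.1) (pairOfRecord F h.params.τ9.M k X)).re| ≤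
            (li F h.params).C₅ * (li F h.params).θ₅ ^ X.1 * Real.exp (-((li F h.params).κ * (domSys (F.P k) h.params.τ9.M X.1).dj X.2)) := by
  rw [s_N18_readingAdm₁₂_iff]
  refine forall₅_congr fun F D h k b => forall₂_congr fun hb hbγ => forall₂_congr fun g hgW => forall_congr' fun U => ⟨fun H X hX => ?_, fun H X => ?_⟩
  · obtain ⟨hA, hB⟩ := re_functionalC_runTowers_of_le S F h.params k g (prependCoupling b g) (ofBackgroundC (ιSU N) (T₀ F h.params k U.1))
      (ofBackgroundC (ιSU N) U.1) X hX
    rw [← hA, ← hB]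
    exact H X
  · rcases Nat.lt_or_ge k X.1 with hX | hX
    · obtain ⟨hA, hB⟩ := re_functionalC_runTowers_eq_zero S F h.params k g (prependCoupling b g) (ofBackgroundC (ιSU N) (T₀ F h.params k U.1))
        (ofBackgroundC (ιSU N) U.1) X hX
      rw [hA, hB, sub_zero, abs_zero]
      exact mul_nonneg (mul_nonneg (hC₅ F h.params) (pow_nonneg (hθ₅ F h.params) _)) (Real.exp_nonneg _)
    · obtain ⟨hA, hB⟩ := re_functionalC_runTowers_of_le S F h.params k g (prependCoupling b g) (ofBackgroundC (ιSU N) (T₀ F h.params k U.1))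
        (ofBackgroundC (ιSU N) U.1) X hX
      rw [hA, hB]
      exact H X hX

/-- **WHAT THE STATEMENT AT THE RUN TOWERS HANDS BACK BELOW THE RUN LENGTH** [bookkeeping; no sign letters]: the η-rate inequality for the UNTRUNCATED towers
at every admissible run-B field and every run-A domain of creation step `j ≤ k`. [cite: Balaban1987RG1, (0.23)-(0.24) pp.256-257, Thm 1 p.259 and (1.18) p.263] -/
theorem le_of_s_N18_readingAdm₁₂_runTowers
    (hS : S_N18 (RRec₁₂ (readingOfRecord₁₂ (fun F θ => ReadingData.ofRecordAdm F θ.τ9.M N (runTowers (S F θ)) (sp F θ) (gauge F θ) (hg F θ) (T₀ F θ) (hT F θ)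
      (li F θ)) ℓ₃ ne2 ne1)))
    {F : T4Family} {D : Datum F N} (hk : IsDatumOfRecord₁₂C F N D) (k : ℕ) {b : ℝ} (hb : 0 < b) (hbγ : b ≤ hk.params.γ) {g : ℕ → ℝ}
    (hgW : g ∈ Window hk.params.γ) {U : GaugeField (F.P (k + 1)) 0 (Node00.SU N)}
    (hU : ∀ (j : ℕ) (Y : (domSys (F.P (k + 1)) hk.params.τ9.M j).Dom), ofBackgroundC (ιSU N) U ∈ sp F hk.params (k + 1) j Y)
    (X : Node00.W1.Dom (F.P k) hk.params.τ9.M) (hX : X.1 ≤ k) :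
    |(functionalC (S F hk.params k) g (ofBackgroundC (ιSU N) (T₀ F hk.params k U)) X).re -
        (functionalC (S F hk.params (k + 1)) (prependCoupling b g) (ofBackgroundC (ιSU N) U) (pairOfRecord F hk.params.τ9.M k X)).re| ≤
      (li F hk.params).C₅ * (li F hk.params).θ₅ ^ X.1 * Real.exp (-((li F hk.params).κ * (domSys (F.P k) hk.params.τ9.M X.1).dj X.2)) := by
  obtain ⟨hA, hB⟩ := re_functionalC_runTowers_of_le S F hk.params k g (prependCoupling b g) (ofBackgroundC (ιSU N) (T₀ F hk.params k U))
    (ofBackgroundC (ιSU N) U) X hX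
  rw [← hA, ← hB]
  exact rate_of_s_N18_readingAdm₁₂ (fun F θ => runTowers (S F θ)) sp gauge hg T₀ hT li ℓ₃ ne2 ne1 hS hk k hb hbγ hgW hU X

/-- **THE θ-FORM SUFFICIENT CONDITION AT THE RUN TOWERS** [bookkeeping]: the inequality for the untruncated towers at every admissible Stage-12 tuple with provisos,
run length `k`, member, history, admissible run-B field and run-A domain of creation step `j ≤ k`, together with the sign letters, gives `S_N18` at the run towers.
[cite: Balaban1987RG1, (0.23)-(0.24) pp.256-257, Thm 1 p.259 and (1.18) p.263] -/
theorem s_N18_readingAdm₁₂_runTowers_of_forall_le (hC₅ : ∀ (F : T4Family) (θ : Stage12Params F N), 0 ≤ (li F θ).C₅)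
    (hθ₅ : ∀ (F : T4Family) (θ : Stage12Params F N), 0 ≤ (li F θ).θ₅)
    (h : ∀ (F : T4Family) (θ : Stage12Params F N), θ.Provisos₁₂ F N → θ.Admissible F N → ∀ (k : ℕ) (b : ℝ), 0 < b → b ≤ θ.γ →
      ∀ g ∈ Window θ.γ, ∀ (U : GaugeField (F.P (k + 1)) 0 (Node00.SU N)),
        (∀ (j : ℕ) (Y : (domSys (F.P (k + 1)) θ.τ9.M j).Dom), ofBackgroundC (ιSU N) U ∈ sp F θ (k + 1) j Y) →
        ∀ X : Node00.W1.Dom (F.P k) θ.τ9.M, X.1 ≤ k →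
          |(functionalC (S F θ k) g (ofBackgroundC (ιSU N) (T₀ F θ k U)) X).re -
              (functionalC (S F θ (k + 1)) (prependCoupling b g) (ofBackgroundC (ιSU N) U) (pairOfRecord F θ.τ9.M k X)).re| ≤
            (li F θ).C₅ * (li F θ).θ₅ ^ X.1 * Real.exp (-((li F θ).κ * (domSys (F.P k) θ.τ9.M X.1).dj X.2))) :
    S_N18 (RRec₁₂ (readingOfRecord₁₂ (fun F θ => ReadingData.ofRecordAdm F θ.τ9.M N (runTowers (S F θ)) (sp F θ) (gauge F θ) (hg F θ) (T₀ F θ) (hT F θ)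
      (li F θ)) ℓ₃ ne2 ne1)) := by
  refine s_N18_readingAdm₁₂_of_forall (fun F θ => runTowers (S F θ)) sp gauge hg T₀ hT li ℓ₃ ne2 ne1 fun F θ hP hA k b hb hbγ g hgW U hU X => ?_
  rcases Nat.lt_or_ge k X.1 with hX | hX
  · obtain ⟨h₁, h₂⟩ := re_functionalC_runTowers_eq_zero S F θ k g (prependCoupling b g) (ofBackgroundC (ιSU N) (T₀ F θ k U)) (ofBackgroundC (ιSU N) U) X hX
    rw [h₁, h₂, sub_zero, abs_zero]
    exact mul_nonneg (mul_nonneg (hC₅ F θ) (pow_nonneg (hθ₅ F θ) _)) (Real.exp_nonneg _)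
  · obtain ⟨h₁, h₂⟩ := re_functionalC_runTowers_of_le S F θ k g (prependCoupling b g) (ofBackgroundC (ιSU N) (T₀ F θ k U)) (ofBackgroundC (ιSU N) U) X hX
    rw [h₁, h₂]
    exact h F θ hP hA k b hb hbγ g hgW U hU X hX

/-! ## §2 The junction row at the run towers: H-layer data below the run length only -/

open Classical in
/-- ★ **MODULE 12 §3's ROW AT THE RUN TOWERS — THE TOWERS' H-LAYER DATA ASKED BELOW THE RUN LENGTH ONLY** [bookkeeping; module 12 §3
`s_N18_readingAdm₁₂_of_envelope_bound238` at `S := fun F θ ↦ runTowers (S′ F θ)`, its hypothesis (ii) «`AnalyticH` + `Bound238` of EVERY step `m` of the run-A tower on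
the table `sp F θ k (m+1)`, of every step of the run-B tower on `sp F θ (k+1) (m+1)`» REBUILT from the steps `m < k` of `S′ F θ k` and `m < k + 1` of `S′ F θ (k+1)`:
the steps at ∕ beyond the run length are W1's TERMLESS steps (`truncRun_of_le`), analytic on any table and (2.38)-bounded with any amplitude `≥ 0` (dag-n18-c's
`analyticH_termlessTower` ∕ `bound238_termlessTower`); W1's eliminator `truncRun_cases`].  Hypothesis (i) — the END's data over the carriers of the admissible level
pairing, L01–L03 on the functionals OF THE RUN TOWERS, rows NE2 ∕ NE3's L07 ∕ L08, the W3 shapes, numerals, L10, sharp clause — verbatim; the letters `li F θ` dominate.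
Conclusion: `S_N18` at the admissible reading on `sp` with the RUN TOWERS.  What (ii) now asks of NODE A ∕ N10 is (2.13an) + (2.38) for the `k` (resp. `k + 1`)
steps the run of record actually performs — FINITE data per run. [cite: Balaban1988RG2Cluster, (2.13) p.14, p.15, (2.16)–(2.18) p.16 and Lemma 3 (2.38) p.20;
Balaban1987RG1, (0.23)–(0.25) pp.256-257, (1.18) p.263 and Thm 1 p.259] -/
theorem s_N18_readingAdm₁₂_runTowers_of_envelope_bound238
    (h : ∀ (F : T4Family) (θ : Stage12Params F N), θ.Provisos₁₂ F N → θ.Admissible F N → ∀ k : ℕ,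
      ∃ (Op : Type) (_ : NormedAddCommGroup Op) (_ : NormedSpace ℂ Op) (Hist : Type) (_ : NormedAddCommGroup Hist) (_ : NormedSpace ℂ Hist)
        (Mb : ℝ → StepModel (LevelPairing.ofRecordAdm F θ.τ9.M N k (sp F θ) (gauge F θ k) (hg F θ k) (T₀ F θ k) (hT F θ k)).carriers Op Hist)
        (act : ℝ → (j : ℕ) → Op × Hist → TDom 4 (domCount (F.P k) θ.τ9.M j) → ℂ) (γ' C3 ε₁ Rd κ A_A A_B E₁ δ δ' θr θ' cH ω ρ₀ B : ℝ) (k₀ : ℕ),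
        -- (i) the END's data over the carriers of the admissible level pairing, functionals OF THE RUN TOWERS
        (∀ b : ℝ, 0 < b → b ≤ γ' → ∀ (X : Node00.W1.Dom (F.P k) θ.τ9.M) (z : Op × Hist),
          (Mb b).Out X.1 z.1 z.2 X =
            locE (TTouch (d := 4) (N := domCount (F.P k) θ.τ9.M X.1)) (fun Z : (tsys 4 (domCount (F.P k) θ.τ9.M X.1)).Dom => Z.1)
              (act b X.1 z) X.2.1) ∧
        0 ≤ C3 ∧ 0 ≤ ε₁ ∧ 0 ≤ κ ∧ κ + 2 * (64 * Real.log 162) + 2 ≤ Rd ∧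
        C3 * ε₁ * Real.exp (5 * κ + 1) * K₀ 64 8 * 9 * 64 ≤ 1 ∧
        (∀ b : ℝ, 0 < b → b ≤ γ' → ∀ j, ∀ g ∈ Window γ',
          ∀ (U : (LevelPairing.ofRecordAdm F θ.τ9.M N k (sp F θ) (gauge F θ k) (hg F θ k) (T₀ F θ k) (hT F θ k)).BgB) (q : Op × Hist),
          q ∈ (Mb b).Base j g U →
          ∃ V : Set (Op × Hist), IsOpen V ∧ (Mb b).box j q ⊆ V ∧
            (∀ Z : TDom 4 (domCount (F.P k) θ.τ9.M j), DifferentiableOn ℂ (fun z : Op × Hist => act b j z Z) V) ∧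
            (∀ z ∈ V, ∀ Z : TDom 4 (domCount (F.P k) θ.τ9.M j), ‖act b j z Z‖ ≤ C3 * ε₁ * Real.exp (-(Rd * torusTreeLen Z.1)))) ∧
        (∀ b : ℝ, 0 < b → b ≤ γ' → L01 (Mb b)
          ((LevelPairing.ofRecordAdm F θ.τ9.M N k (sp F θ) (gauge F θ k) (hg F θ k) (T₀ F θ k) (hT F θ k)).EA (runTowers (S F θ) k)) (Window γ')) ∧
        (∀ b : ℝ, 0 < b → b ≤ γ' → L02 (Mb b)
          ((LevelPairing.ofRecordAdm F θ.τ9.M N k (sp F θ) (gauge F θ k) (hg F θ k) (T₀ F θ k) (hT F θ k)).EB (runTowers (S F θ) (k + 1)) b)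
          (Window γ')) ∧
        (∀ b : ℝ, 0 < b → b ≤ γ' → L03 (Mb b)
          ((LevelPairing.ofRecordAdm F θ.τ9.M N k (sp F θ) (gauge F θ k) (hg F θ k) (T₀ F θ k) (hT F θ k)).EB (runTowers (S F θ) (k + 1)) b)
          (Window γ')) ∧
        (∀ b : ℝ, 0 < b → b ≤ γ' → L07 (Mb b) (Window γ') δ θr) ∧
        (∀ b : ℝ, 0 < b → b ≤ γ' → L08 (Mb b) (Window γ') κ (Real.exp 1 * 9 * 64 * K₀ 64 8 ^ 2 * A_B) δ' θr) ∧
        (∀ b : ℝ, 0 < b → b ≤ γ' → L09aff (Mb b) (Window γ')) ∧ (∀ b : ℝ, 0 < b → b ≤ γ' → L09blind (Mb b) (Window γ')) ∧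
        (∀ b : ℝ, 0 < b → b ≤ γ' → L09hom (Mb b) (Window γ')) ∧ (∀ b : ℝ, 0 < b → b ≤ γ' → L09unit (Mb b) (Window γ') κ E₁ cH ω) ∧
        0 < E₁ ∧ 0 ≤ δ + δ' ∧ 0 ≤ θr ∧ θr ≤ θ' ∧ θ' ≤ 1 ∧ 0 ≤ cH ∧ 0 < ω ∧ ρ₀ < 1 ∧
        (δ + δ') * θr ^ k₀ +
            cH * (Real.exp 1 * 9 * 64 * K₀ 64 8 ^ 2 * A_A + Real.exp 1 * 9 * 64 * K₀ 64 8 ^ 2 * A_B) / (1 - ω) ≤ ρ₀ ∧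
        0 ≤ B ∧ (∀ k < k₀, Real.exp 1 * 9 * 64 * K₀ 64 8 ^ 2 * A_A + Real.exp 1 * 9 * 64 * K₀ 64 8 ^ 2 * A_B ≤ B * θr ^ k) ∧
        Real.exp 1 * 9 * 64 * K₀ 64 8 ^ 2 * C3 * cH * ε₁ < (θ' - ω) * (1 - ρ₀) ∧
        -- (ii) the towers' H-layer data in the configuration direction ON THE TABLES, BELOW THE RUN LENGTH ONLY, both runs
        (∀ m, SpRestr (sp F θ k (m + 1))) ∧
        (∀ m < k, (S F θ k m).AnalyticH (box γ' m) (sp F θ k (m + 1)) ∧ (S F θ k m).Bound238 (box γ' m) (sp F θ k (m + 1)) A_A Rd) ∧ 0 ≤ A_A ∧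
        A_A * Real.exp (5 * κ + 1) * K₀ 64 8 * 9 * 64 < 1 ∧
        (∀ m, SpRestr (sp F θ (k + 1) (m + 1))) ∧
        (∀ m < k + 1, (S F θ (k + 1) m).AnalyticH (box γ' m) (sp F θ (k + 1) (m + 1)) ∧
          (S F θ (k + 1) m).Bound238 (box γ' m) (sp F θ (k + 1) (m + 1)) A_B Rd) ∧
        0 ≤ A_B ∧ A_B * Real.exp (5 * κ + 1) * K₀ 64 8 * 9 * 64 < 1 ∧
        -- the reading's letters dominate the END's
        θ.γ ≤ γ' ∧ (li F θ).κ ≤ κ ∧ θ' ≤ (li F θ).θ₅ ∧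
        (Real.exp 1 * 9 * 64 * K₀ 64 8 ^ 2 * (C3 * ε₁) / (1 - ρ₀) * (δ + δ') + B) * (θ' - ω) /
            (θ' - (ω + Real.exp 1 * 9 * 64 * K₀ 64 8 ^ 2 * (C3 * ε₁) / (1 - ρ₀) * cH)) ≤ (li F θ).C₅) :
    S_N18 (RRec₁₂ (readingOfRecord₁₂ (fun F θ => ReadingData.ofRecordAdm F θ.τ9.M N (runTowers (S F θ)) (sp F θ) (gauge F θ) (hg F θ) (T₀ F θ) (hT F θ)
      (li F θ)) ℓ₃ ne2 ne1)) := by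
  refine s_N18_readingAdm₁₂_of_envelope_bound238 (fun F θ => runTowers (S F θ)) sp gauge hg T₀ hT li ℓ₃ ne2 ne1 fun F θ hP hA k => ?_
  obtain ⟨Op, iO₁, iO₂, Hist, iH₁, iH₂, Mb, act, γ', C3, ε₁, Rd, κ, A_A, A_B, E₁, δ, δ', θr, θ', cH, ω, ρ₀, B, k₀, hrep, hC3, hε₁, hκ, hrate, hKP, hH,
    l01, l02, l03, l07, l08, l09aff, l09blind, l09hom, l09unit, hE₁, hδ, hθ, hθθ', hθ'1, hcH, hω, hρ₀, l10near, hB, l10first, hS, hrestrA,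
    hHA, hAA, hsmallA, hrestrB, hHB, hAB, hsmallB, hγ, hℓκ, hℓθ, hℓC⟩ := h F θ hP hA k
  exact ⟨Op, iO₁, iO₂, Hist, iH₁, iH₂, Mb, act, γ', C3, ε₁, Rd, κ, A_A, A_B, E₁, δ, δ', θr, θ', cH, ω, ρ₀, B, k₀, hrep, hC3, hε₁, hκ, hrate, hKP, hH,
    l01, l02, l03, l07, l08, l09aff, l09blind, l09hom, l09unit, hE₁, hδ, hθ, hθθ', hθ'1, hcH, hω, hρ₀, l10near, hB, l10first, hS, hrestrA,
    truncRun_cases (S F θ k) (Q := fun m (st : Node00.W1.ClusterStep (F.P k) (MatA N) θ.τ9.M m) => st.AnalyticH (box γ' m) (sp F θ k (m + 1)))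
      (fun m hm => (hHA m hm).1) (fun m _ => analyticH_termlessTower m _ _),
    truncRun_cases (S F θ k) (Q := fun m (st : Node00.W1.ClusterStep (F.P k) (MatA N) θ.τ9.M m) => st.Bound238 (box γ' m) (sp F θ k (m + 1)) A_A Rd)
      (fun m hm => (hHA m hm).2) (fun m _ => bound238_termlessTower m _ _ hAA),
    hAA, hsmallA, hrestrB,
    truncRun_cases (S F θ (k + 1)) (Q := fun m (st : Node00.W1.ClusterStep (F.P (k + 1)) (MatA N) θ.τ9.M m) => st.AnalyticH (box γ' m) (sp F θ (k + 1) (m + 1)))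
      (fun m hm => (hHB m hm).1) (fun m _ => analyticH_termlessTower m _ _),
    truncRun_cases (S F θ (k + 1))
      (Q := fun m (st : Node00.W1.ClusterStep (F.P (k + 1)) (MatA N) θ.τ9.M m) => st.Bound238 (box γ' m) (sp F θ (k + 1) (m + 1)) A_B Rd)
      (fun m hm => (hHB m hm).2) (fun m _ => bound238_termlessTower m _ _ hAB),
    hAB, hsmallB, hγ, hℓκ, hℓθ, hℓC⟩

end Record

end YMDAG.N18.W1Reading

end
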